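import Summits.QuantumFields.QCD.Theorems.WilsonMobilityGapChiralMobilityGapSketchDefs
import Summits.QuantumFields.QCD.Theorems.PauliWegnerSeaChiralGluonicCompletionDefs
import Literature.MathematicalPhysics.QuantumFieldTheory.QCDGoldstoneBound

/-!
# Stub `stub_goldstone_of_signInputs_three` of line `Sketch`
# (crux `PauliWegnerSea.ChiralGluonicCompletion`, stmt-QuantumFields-17498) — the `N_f = 3` Goldstone assembly

The chirality engine of line `Sketch` at three flavours is split (skeleton rev 3, cycle 2) into the OPEN core
`stub_core_three : Hyp 3 reg → ∃ φ, VanishingChiralRate ∧ SuperLogVolume ∧ PionWeightSignCoherent` along `reg.restrict φ`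
(the three `N_f = 3` add-ons of the sibling crux `ChiralMobilityGap`'s `MobilityGapPlus`, stmt-QuantumFields-17497,
`…ChiralMobilityGapSketchDefs.lean`) and THIS provable assembly, stated for an arbitrary three-flavour regularisation:

* `stub_goldstone_of_signInputs_three` (the registered stub) — the EVENTUAL strengthening of 17497's landed first lemma
  `ChiralMobilityGapSketch.stub_pinThree` (same mechanism, ending in `HasGoldstoneBoundAt ε` instead of
  `¬ HasLatticeMassGap ε`): clause (iv) `Sign` at every degenerate triple (denominator `0 < ‖∫det D‖`,
  `‖∫det D‖ ≤ ∫|det D|`), super-logarithmic volumes `SuperLogVolume` (`a_k L_k / log(L_k+2) → ∞`, to absorb the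
  log-loss of clause (iii) at the forced choice `S = n = L_k`), sign coherence of the pion-WEIGHTED determinant at the
  scheme's own side `PionWeightSignCoherent` (the ONE signed input on the numerator) and `VanishingChiralRate` (clause
  (iii) at degenerate triples with physical rate `2C₁/s < ε` for every `ε`) give `reg.HasGoldstoneBound` on the SAME
  regularisation, witnessed at `S_k = n_k = L_k` with the charged pion pair `ψ̄₁γ₅ψ₀`, `ψ̄₀γ₅ψ₁`.
* `goldstone_three_of_core` — the skeleton's `N_f = 3` branch as a lemma: the core along `φ` plus clause (iv) of `Hyp`
  along `φ` give the Goldstone bound of `reg.restrict φ`; `goldstone_three_of_core_sameReg` is the `φ = id` form.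
  What `Hyp 3 reg` lacks is precisely the three predicates (worker verdict cycle 2: `stub-blocked` on 17497's `stub_core`).
-/

noncomputable section

namespace Summit.QuantumFields.QCD.Theorems.StronglyChiralSubsequence

open scoped BigOperators Topology
open MeasureTheory Filter Set
open Literature.MathematicalPhysics.QuantumFieldTheory Literature.MathematicalPhysics.QuantumLattice
  Literature.Probability.LatticeModels
open Summit.QuantumFields.QCD.Theorems.MobilityGapNegative (bare fm Sign)
open Summit.QuantumFields.QCD.Theorems.ChiralMobilityGapSketch

/-- **Eventual Goldstone bound at `N_f = 3` from the sign inputs** (the eventual twin of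
`ChiralMobilityGapSketch.stub_pinThree`).  With clause (iv) SIGN along degenerate triples, super-logarithmic
volumes, sign coherence of the pion-weighted determinant at the scheme's own side and clause (iii) with
vanishing physical rate, the regularisation carries the eventual Goldstone lower bound: for `ε > 0`, at the
triple `(t,t,t)` and `S_k = n_k = L_k`,
`‖corr_k‖ ≥ c_σ E₊[X_k] ≥ (c_σ c₀^{2/s}/144) e^{-((2C₁/s) a_k L_k + (2p/s) log(L_k+1))} ≥ e^{-μ a_k L_k}` eventually,
`μ = (2C₁/s + ε)/2 < ε` (`stub_pionSigned`, `stub_momentCompare`, `stub_acrossK`). [folklore] -/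
theorem stub_goldstone_of_signInputs_three : ∀ reg : QCDRegularisation 3, (∀ t : ℝ, 0 < t → Sign reg (fun _ => t)) →
    SuperLogVolume reg → PionWeightSignCoherent reg → VanishingChiralRate reg → reg.HasGoldstoneBound := by
  intro reg hSignAll hL hσ hV ε hε
  obtain ⟨t, ht, s, c₀, C₁, p, hs, hs1, hc₀, hC₁, hLow⟩ := hV ε hε
  have hLow' : ∀ᶠ k in atTop, ∀ S : ℕ, reg.L k ≤ S → ∀ (f : Fin 3) (n : ℕ), n ≤ S →
      c₀ * Real.exp (-(C₁ * (reg.a k * n) + p * Real.log (n + 1))) ≤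
        fm 3 (reg.β k) (bare reg (fun _ => t) k) S f (Pi.single 0 (n : ℤ)) s := hLow
  obtain ⟨cσ, hcσ, hσk⟩ := hσ t ht
  have hSign : Sign reg (fun _ => t) := hSignAll t ht
  have hL' : Tendsto (fun k => reg.a k * reg.L k / Real.log ((reg.L k : ℝ) + 2)) atTop atTop := hL
  set r : ℝ := 2 * C₁ / s with hrdef
  have hr : r < ε := by rw [hrdef, div_lt_iff₀ hs]; linarith
  set μ : ℝ := (r + ε) / 2 with hμdef
  have hrμ : r < μ := by rw [hμdef]; linarith
  have hμε : μ < ε := by rw [hμdef]; linarith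
  have hK : 0 < cσ * c₀ ^ (2 / s) / 144 := by positivity
  have hacross := stub_acrossK reg.a reg.L reg.a_pos reg.tendsto_L hL' (p := 2 * p / s) hrμ hK
  refine ⟨fun _ => t, fun _ => ht, μ, 1, hμε, one_pos, 1, 1,
    pseudoscalarDensityObs 3 (Matrix.single (1 : Fin 3) 0 (1 : ℂ)),
    pseudoscalarDensityObs 3 (Matrix.single (0 : Fin 3) 1 (1 : ℂ)), reg.L, reg.L,
    fun k => le_rfl, fun k => le_rfl, reg.tendsto_L, ?_⟩
  filter_upwards [hLow', hσk, hSign, hacross] with k hk hσk' hsg hak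
  -- the data at step `k`
  set c : ℝ := reg.mcrit k + reg.a k * t / reg.Zm k with hcdef
  have hbare : bare reg (fun _ => t) k = fun _ : Fin 3 => c := rfl
  have hmq : (fun fl => (reg.scheme (fun _ => t) 0 0).mq fl k) = fun _ : Fin 3 => c := rfl
  have hβ : (reg.scheme (fun _ => t) 0 0).β k = reg.β k := rfl
  set X : GaugeConfig 4 (2 * reg.L k + 1) SU3 → ℝ := fun U =>
      ∑ a : Fin 3, ∑ i : Fin 4, ∑ b : Fin 3, ∑ j : Fin 4,
        ‖(diracMatrix U (fun _ : Fin 3 => c))⁻¹ (quarkEquiv ((0 : Fin 3), (Torus.proj (2 * reg.L k + 1) 0, a, i)))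
          (quarkEquiv ((0 : Fin 3), (Torus.proj (2 * reg.L k + 1) (Pi.single 0 (reg.L k : ℤ)), b, j)))‖ ^ (2 : ℕ)
    with hXdef
  have hX0 : ∀ U, 0 ≤ X U := fun U => by rw [hXdef]; positivity
  -- the signed correlator
  have hcorr : qcdLatticeConnectedCorr (reg.β k) (2 * reg.L k + 1)
      (fun fl => (reg.scheme (fun _ => t) 0 0).mq fl k)
      (pseudoscalarDensityObs 3 (Matrix.single (1 : Fin 3) 0 (1 : ℂ)))
      (pseudoscalarDensityObs 3 (Matrix.single (0 : Fin 3) 1 (1 : ℂ))) (reg.L k) =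
      -((∫ U, (diracMatrix U (fun _ : Fin 3 => c)).det * ((X U : ℝ) : ℂ)
            ∂(wilsonMeasure (d := 4) (L := 2 * reg.L k + 1) (fundamentalRep (Fin 3)) (reg.β k))) /
          (∫ U, (diracMatrix U (fun _ : Fin 3 => c)).det
            ∂(wilsonMeasure (d := 4) (L := 2 * reg.L k + 1) (fundamentalRep (Fin 3)) (reg.β k)))) := by
    rw [hmq, stub_pionSigned (reg.β k) (reg.L k) (fun _ : Fin 3 => c) 0 1 zero_ne_one rfl (reg.L k)]
  -- denominators: `0 < ‖∫ det‖ ≤ ∫ |det|` (clause (iv) at the scheme's own side)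
  have hZ : 0 < ∫ U, ‖(diracMatrix U (fun _ : Fin 3 => c)).det‖
      ∂(wilsonMeasure (d := 4) (L := 2 * reg.L k + 1) (fundamentalRep (Fin 3)) (reg.β k)) :=
    integral_norm_det_diracMatrix_pos_all (S := 2 * reg.L k + 1) (reg.β k) (fun _ : Fin 3 => c)
  have hsg' : (1 / 2 : ℝ) ≤
      ‖∫ U, (diracMatrix U (fun _ : Fin 3 => c)).det
          ∂(wilsonMeasure (d := 4) (L := 2 * reg.L k + 1) (fundamentalRep (Fin 3)) (reg.β k))‖ /
        ∫ U, ‖(diracMatrix U (fun _ : Fin 3 => c)).det‖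
          ∂(wilsonMeasure (d := 4) (L := 2 * reg.L k + 1) (fundamentalRep (Fin 3)) (reg.β k)) := hsg
  have hD0 : 0 < ‖∫ U, (diracMatrix U (fun _ : Fin 3 => c)).det
      ∂(wilsonMeasure (d := 4) (L := 2 * reg.L k + 1) (fundamentalRep (Fin 3)) (reg.β k))‖ := by
    have h1 : (0 : ℝ) < 1 / 2 * ∫ U, ‖(diracMatrix U (fun _ : Fin 3 => c)).det‖
        ∂(wilsonMeasure (d := 4) (L := 2 * reg.L k + 1) (fundamentalRep (Fin 3)) (reg.β k)) :=
      mul_pos (by norm_num) hZ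
    exact h1.trans_le ((le_div_iff₀ hZ).1 hsg')
  have hDle : ‖∫ U, (diracMatrix U (fun _ : Fin 3 => c)).det
      ∂(wilsonMeasure (d := 4) (L := 2 * reg.L k + 1) (fundamentalRep (Fin 3)) (reg.β k))‖ ≤
      ∫ U, ‖(diracMatrix U (fun _ : Fin 3 => c)).det‖
        ∂(wilsonMeasure (d := 4) (L := 2 * reg.L k + 1) (fundamentalRep (Fin 3)) (reg.β k)) :=
    norm_integral_le_integral_norm _
  -- numerator: sign coherence of the pion weight
  have hNum : cσ * ∫ U, ‖(diracMatrix U (fun _ : Fin 3 => c)).det‖ * X U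
      ∂(wilsonMeasure (d := 4) (L := 2 * reg.L k + 1) (fundamentalRep (Fin 3)) (reg.β k)) ≤
      ‖∫ U, (diracMatrix U (fun _ : Fin 3 => c)).det * ((X U : ℝ) : ℂ)
        ∂(wilsonMeasure (d := 4) (L := 2 * reg.L k + 1) (fundamentalRep (Fin 3)) (reg.β k))‖ := hσk'
  -- `‖corr‖ ≥ cσ E₊[X]`
  have hE : qcdPhaseQuenchedExpect (reg.β k) (2 * reg.L k + 1) (fun _ : Fin 3 => c) X =
      (∫ U, ‖(diracMatrix U (fun _ : Fin 3 => c)).det‖ * X U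
          ∂(wilsonMeasure (d := 4) (L := 2 * reg.L k + 1) (fundamentalRep (Fin 3)) (reg.β k))) /
        ∫ U, ‖(diracMatrix U (fun _ : Fin 3 => c)).det‖
          ∂(wilsonMeasure (d := 4) (L := 2 * reg.L k + 1) (fundamentalRep (Fin 3)) (reg.β k)) :=
    qcdPhaseQuenchedExpect_eq_div _ _ _
  have hstep1 : cσ * qcdPhaseQuenchedExpect (reg.β k) (2 * reg.L k + 1) (fun _ : Fin 3 => c) X ≤
      ‖qcdLatticeConnectedCorr (reg.β k) (2 * reg.L k + 1)
        (fun fl => (reg.scheme (fun _ => t) 0 0).mq fl k)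
        (pseudoscalarDensityObs 3 (Matrix.single (1 : Fin 3) 0 (1 : ℂ)))
        (pseudoscalarDensityObs 3 (Matrix.single (0 : Fin 3) 1 (1 : ℂ))) (reg.L k)‖ := by
    rw [hcorr, norm_neg, norm_div, hE, mul_div_assoc']
    exact (div_le_div_of_nonneg_right hNum hZ.le).trans
      (div_le_div_of_nonneg_left (norm_nonneg _) hD0 hDle)
  -- moments and the lower bound of (iii) at `n = S = L_k`, flavour `0`
  have hmom : fm 3 (reg.β k) (fun _ => c) (reg.L k) 0 (Pi.single 0 (reg.L k : ℤ)) s ^ (2 / s) ≤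
      144 * qcdPhaseQuenchedExpect (reg.β k) (2 * reg.L k + 1) (fun _ : Fin 3 => c) X :=
    stub_momentCompare (Nf := 3) (by norm_num) (reg.β k) c (reg.L k) 0 (Pi.single 0 (reg.L k : ℤ)) hs hs1.le
  have hlow : c₀ * Real.exp (-(C₁ * (reg.a k * reg.L k) + p * Real.log (reg.L k + 1))) ≤
      fm 3 (reg.β k) (fun _ => c) (reg.L k) 0 (Pi.single 0 (reg.L k : ℤ)) s := by
    have := hk (reg.L k) le_rfl 0 (reg.L k) le_rfl
    rwa [hbare] at this
  have hq : 0 ≤ 2 / s := by positivity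
  have hpow := Real.rpow_le_rpow (by positivity) hlow hq
  have hval : (c₀ * Real.exp (-(C₁ * (reg.a k * reg.L k) + p * Real.log (reg.L k + 1)))) ^ (2 / s) =
      c₀ ^ (2 / s) * Real.exp (-(r * (reg.a k * reg.L k) + 2 * p / s * Real.log (reg.L k + 1))) := by
    rw [Real.mul_rpow hc₀.le (Real.exp_pos _).le, ← Real.exp_mul, hrdef]
    congr 2
    ring
  have hmom' : c₀ ^ (2 / s) * Real.exp (-(r * (reg.a k * reg.L k) + 2 * p / s * Real.log (reg.L k + 1))) ≤
      144 * qcdPhaseQuenchedExpect (reg.β k) (2 * reg.L k + 1) (fun _ : Fin 3 => c) X := by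
    rw [← hval]
    exact hpow.trans hmom
  -- assemble
  have hfin : cσ * c₀ ^ (2 / s) / 144 *
      Real.exp (-(r * (reg.a k * reg.L k) + 2 * p / s * Real.log (reg.L k + 1))) ≤
      cσ * qcdPhaseQuenchedExpect (reg.β k) (2 * reg.L k + 1) (fun _ : Fin 3 => c) X := by
    have := mul_le_mul_of_nonneg_left hmom' hcσ.le
    linarith
  rw [one_mul]
  exact hak.trans (hfin.trans hstep1)

/-- **Calibration of `stub_goldstone_three`.**  If the crux's package `Hyp 3 reg` yields, along SOME subsequence
`reg.restrict φ`, the three `N_f = 3` add-ons of `ChiralMobilityGapSketch.MobilityGapPlus` — `VanishingChiralRate`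
(clause (iii) at degenerate triples with physical rate `2C₁/s → 0` as the mass `→ 0⁺`), `SuperLogVolume` and
`PionWeightSignCoherent` (sign coherence of the pion-weighted determinant at the scheme's own side) — then the
stub holds: clause (iv) of `Hyp` at the degenerate triples passes to every subsequence and
`stub_goldstone_of_signInputs_three` applies to `reg.restrict φ`. [folklore] -/
theorem goldstone_three_of_core
    (hcore : ∀ reg : QCDRegularisation 3, Hyp 3 reg → ∃ φ : ℕ → ℕ, ∃ hφ : StrictMono φ,
      VanishingChiralRate (reg.restrict φ hφ.tendsto_atTop) ∧ SuperLogVolume (reg.restrict φ hφ.tendsto_atTop) ∧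
        PionWeightSignCoherent (reg.restrict φ hφ.tendsto_atTop)) :
    ∀ reg : QCDRegularisation 3, Hyp 3 reg →
      ∃ φ : ℕ → ℕ, ∃ hφ : StrictMono φ, (reg.restrict φ hφ.tendsto_atTop).HasGoldstoneBound := by
  intro reg hH
  obtain ⟨φ, hφ, hV, hL, hσ⟩ := hcore reg hH
  refine ⟨φ, hφ, stub_goldstone_of_signInputs_three _ (fun t ht => ?_) hL hσ hV⟩
  -- clause (iv) of `Hyp` at the degenerate triple `(t,t,t)`, along `φ`
  have hIV : ClauseIV 3 reg (fun _ => t) := (hH.2.2.2 (fun _ => t) fun _ => ht).1.2.2.2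
  exact hφ.tendsto_atTop.eventually hIV

/-- **Calibration of `stub_goldstone_three`, same-regularisation form** (`φ = id`): if `Hyp 3 reg` yields the
three add-ons on `reg` itself, the stub holds with the identity subsequence (`HasGoldstoneBound.restrict`).
[folklore] -/
theorem goldstone_three_of_core_sameReg
    (hcore : ∀ reg : QCDRegularisation 3, Hyp 3 reg →
      VanishingChiralRate reg ∧ SuperLogVolume reg ∧ PionWeightSignCoherent reg) :
    ∀ reg : QCDRegularisation 3, Hyp 3 reg →
      ∃ φ : ℕ → ℕ, ∃ hφ : StrictMono φ, (reg.restrict φ hφ.tendsto_atTop).HasGoldstoneBound := by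
  intro reg hH
  obtain ⟨hV, hL, hσ⟩ := hcore reg hH
  have hG : reg.HasGoldstoneBound :=
    stub_goldstone_of_signInputs_three reg (fun t ht => (hH.2.2.2 (fun _ => t) fun _ => ht).1.2.2.2) hL hσ hV
  exact ⟨id, strictMono_id, hG.restrict id strictMono_id.tendsto_atTop⟩

end Summit.QuantumFields.QCD.Theorems.StronglyChiralSubsequence

end
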